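import Summits.ResolutionOfSingularities.ResolutionOfSingularities.Theorems.FrobeniusClosingPatchingRelPerfectDepthLegalLoop
import Summits.ResolutionOfSingularities.ResolutionOfSingularities.Theorems.FrobeniusClosingPatchingRelPerfectDepthLegalOraclePoint
import Summits.ResolutionOfSingularities.ResolutionOfSingularities.Theorems.FrobeniusClosingPatchingRelPerfectDepthLegalDoubleCurve
import Summits.ResolutionOfSingularities.ResolutionOfSingularities.Theorems.FrobeniusClosingPatchingRelPerfectDepthLegalInvStep
import Summits.ResolutionOfSingularities.ResolutionOfSingularities.Theorems.FrobeniusClosingPatchingRelPerfectDepthLegalExitMulti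
import Summits.ResolutionOfSingularities.ResolutionOfSingularities.Theorems.FrobeniusClosingPatchingRelPerfectDepthOneRegularizeSupportEnd
import Literature.AlgebraicGeometry.Resolution.StrictNormalCrossingsHasSNC
import Literature.AlgebraicGeometry.Resolution.KollarBlowupSequenceFunctors
import Literature.AlgebraicGeometry.Resolution.BlowupDimension
import HarnessLib

/-!
# Crux `PatchingRelPerfect` (stmt-ResolutionOfSingularities-16161), chain W5.2 — T6-E1b residual `LegalScopedDivisorReduction₃`,
# PHASE 2 closer (2b), spec D4: THE CURVE-CHOOSING ORACLE `curveOracle₃` (global assembly)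

[OURS · L1 W5.2 · res-D-pv-052 g6 for the (2b) ORACLE O3, BY NAME from res-L1-w52-lead-1's `ORACLE-HANDOFF.md` (873ae9ed5877222f) and
`PHASE2-STEPB-SPEC.md` §D4 ORACLE PLAN] Replaces the role of NO printed item; NOT a statement of the manuscript under review; fact-free.

The curve-move loop `DepthLegal.curve_loop` (…DepthLegalLoop) is generic in a curve-choosing ORACLE `CurveOracle Inv`.  This file supplies
the oracle for the invariant
`Inv₃ H N D L := (∃ BX ⊆ V(D), BX a strict normal crossings divisor of the host surface with Supp (M|_{V(D)}) ⊆ BX) ∧ dim E ≤ 3`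
(STEP A's export plus the dimension bound): at a pruned state (all exponents positive) with integral host `X = V(D)` and trace
`T = M|_X ≠ 0, ≠ 𝒪`, some codimension-one point `ζ` of `Supp T` has its curve `Γ = cl{ι ζ} ⊂ E` normal crossings with the boundary,
and `Inv₃` survives the move along `Γ`.  The choice follows the classical PRIORITY RULE
(b) a DOUBLE curve (`ι ζ` on two distinct members; `…DepthLegalDoubleCurve`) if there is one, else
(a) a TANGENCY curve (`F|_X ≤ 𝓘_X(cl ζ)²` for the member `F ∋ ι ζ`) if there is one, else (c) any curve;
in cases (a)/(c) normal crossings are checked pointwise by the POINTWISE ORACLE LEMMA `sncWithAt_curve_of_unique_member`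
(…DepthLegalOraclePoint), fed with the labelled branches of `BX` through the point (`IsStrictNormalCrossingsDivisor.exists_hasSNC`,
at most two since `dim 𝒪_{X,x} ≤ 2`), their generic points (the component ideals are the `𝓘(cl η)`, `η` maximal in `BX`), and the
priority hypotheses transported from the divisorial points of `T` to the branches through `x` (a branch on a member is a component of
`Supp T`).  `Inv₃` after the move: `snc_inv_step` (…DepthLegalInvStep) along the isomorphism of hosts of `HostStateN.curve_move`, and
`IsBlowup.topologicalKrullDim_le`.

* `HostStateN.exists_stalkIdeal_trace_eq_span` — the trace has principal non-zero stalks;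
* `HostStateN.exists_mem_divisorialPoints_trace` — a proper non-zero trace has a codimension-one point (Krull);
* `HostStateN.inv₃_step` — `Inv₃` of the moved (pruned) state;
* `HostStateN.hasSNCWith_curve` — cases (a)/(c): the global normal-crossings statement from the pointwise lemma;
* `curveOracle₃ : CurveOracle Inv₃`.

AI-written; AI review is weaker than expert review.

## References
* J. Kollár, *Lectures on Resolution of Singularities* (2007), 3.104 Step 2.1, (3.111) Step 3. [Kollar2007]
* V. Cossart, O. Piltant, J. Algebra 320 (2008), proof of Prop. 4.2 (divisorial points). [CossartPiltant2008]
* The Stacks Project, Tags 0BIA, 01J7, 00KV. [StacksProject]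
-/

-- `Summit.<Summit>.<Sub>.Theorems` with `Sub = Summit` (single-conjunct summit, D-0017)
set_option linter.dupNamespace false

noncomputable section

open CategoryTheory CategoryTheory.Limits AlgebraicGeometry TopologicalSpace IsLocalRing
open Literature.AlgebraicGeometry.Resolution Scheme.IdealSheafData

namespace Summit.ResolutionOfSingularities.ResolutionOfSingularities.Theorems

universe u

namespace DepthLegal

open WeightTwoB DepthTargets DepthSNC

namespace HostStateN

variable {E : Scheme.{u}} [IsNoetherian E] {H N D : E.IdealSheafData} {L : List (E.IdealSheafData × ℕ)}
  (S : HostStateN H N D L)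

/-! ## §1 The trace: principal non-zero stalks, divisorial points, members -/

include S in
/-- The trace `T = M|_X` of the boundary monomial on the integral host has PRINCIPAL NON-ZERO stalks (order-`w` monomial generators of `M`
pushed to `X`; non-zero because `T ≠ 0` on the integral `X`). [cite: Kollar2007, (3.111) Step 3] -/
theorem exists_stalkIdeal_trace_eq_span [IsIntegral D.subscheme] (hT : (monomialIdeal L).comap D.subschemeι ≠ ⊥)
    (x : D.subscheme) :
    ∃ g : D.subscheme.presheaf.stalk x, stalkIdeal ((monomialIdeal L).comap D.subschemeι) x = Ideal.span {g} ∧ g ≠ 0 := by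
  haveI : IsRegularLocalRing (E.presheaf.stalk (D.subschemeι x)) := S.regE _
  obtain ⟨g, hg, -, -⟩ := exists_generator_stalkIdeal_monomialIdeal L (x := D.subschemeι x)
    (fun p hp hxp => S.sncB.exists_generator_of_mem (fst_mem_boundaryOf hp) hxp)
  refine ⟨(D.subschemeι.stalkMap x).hom g, ?_, fun h0 => ?_⟩
  · rw [stalkIdeal_comap_eq_map, hg, Ideal.map_span, Set.image_singleton]
  · apply stalkIdeal_ne_bot_of_ne_bot hT x
    rw [stalkIdeal_comap_eq_map, hg, Ideal.map_span, Set.image_singleton, h0, Ideal.span_singleton_eq_bot]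

include S in
/-- A proper non-zero trace has a CODIMENSION-ONE point (Krull's Hauptidealsatz at any point of its support).
[cite: StacksProject, Tag 00KV] -/
theorem exists_mem_divisorialPoints_trace [IsIntegral D.subscheme] (hT : (monomialIdeal L).comap D.subschemeι ≠ ⊥)
    (hT' : (monomialIdeal L).comap D.subschemeι ≠ ⊤) :
    ∃ ζ : D.subscheme, ζ ∈ divisorialPoints ((monomialIdeal L).comap D.subschemeι) := by
  haveI : AlgebraicGeometry.IsNoetherian D.subscheme := isNoetherian_subscheme D
  have hne : (((monomialIdeal L).comap D.subschemeι).support : Set D.subscheme).Nonempty := by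
    rw [Set.nonempty_iff_ne_empty]
    intro h0
    apply hT'
    rw [← Scheme.IdealSheafData.support_eq_bot_iff]
    exact SetLike.coe_injective (by rw [h0]; rfl)
  obtain ⟨x, hx⟩ := hne
  obtain ⟨g, hg, hg0⟩ := S.exists_stalkIdeal_trace_eq_span hT x
  obtain ⟨ζ, -, hζ⟩ := exists_specializes_mem_divisorialPoints _ hg hg0 hx
  exact ⟨ζ, hζ⟩

omit [AlgebraicGeometry.IsNoetherian E] in
/-- `M ≤ F` for every member `F` of a boundary list with POSITIVE exponents. [folklore] -/
theorem monomialIdeal_le_of_mem_boundaryOf (hpos : ∀ p ∈ L, 0 < p.2) {F : E.IdealSheafData} (hF : F ∈ boundaryOf L) :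
    monomialIdeal L ≤ F := by
  obtain ⟨a, ha⟩ := mem_boundaryOf_iff.mp hF
  have h1 : monomialIdeal L ≤ F ^ a := by
    clear hF
    induction L with
    | nil => exact absurd ha List.not_mem_nil
    | cons q L ih =>
      rw [monomialIdeal_cons]
      rcases List.mem_cons.mp ha with h | h
      · rw [← h]; exact Scheme.IdealSheafData.le_def.mpr fun U => by
          rw [Scheme.IdealSheafData.ideal_mul, Pi.mul_apply]; exact Ideal.mul_le_right
      · exact (mul_le_of_inert _ _).trans (ih (fun p hp => hpos p (List.mem_cons_of_mem _ hp)) h)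
  have ha1 : 1 ≤ a := hpos (F, a) ha
  obtain ⟨k, hk⟩ := Nat.exists_eq_add_of_le ha1
  refine h1.trans ?_
  rw [hk, pow_add, pow_one]
  exact Scheme.IdealSheafData.le_def.mpr fun U => by
    rw [Scheme.IdealSheafData.ideal_mul, Pi.mul_apply]; exact Ideal.mul_le_right

omit [AlgebraicGeometry.IsNoetherian E] in
/-- A point of the trace lies on some member of the boundary. [folklore] -/
theorem exists_mem_boundaryOf_of_mem_support_trace {ζ : D.subscheme}
    (hζ : ζ ∈ ((monomialIdeal L).comap D.subschemeι).support) : ∃ F ∈ boundaryOf L, D.subschemeι ζ ∈ F.support := by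
  obtain ⟨p, hp, -, hζp⟩ := DepthHostLaw.exists_mem_support_of_mem_support_monomialIdeal
    ((mem_support_comap_iff D.subschemeι (monomialIdeal L) ζ).mp hζ)
  exact ⟨p.1, fst_mem_boundaryOf hp, hζp⟩

/-! ## §2 `Inv₃` survives the move -/

include S in
/-- **`Inv₃` after a curve move** (for the PRUNED new exponent list): the trace still lies in a strict normal crossings divisor of the
new host (`snc_inv_step` along the isomorphism `π_X` of `curve_move`, whose trace law reads `T𝒪 = 𝓟_ζ𝒪 · T′`), and the dimension bound
passes to the blow-up. [cite: Kollar2007, 3.104 Step 2.1] -/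
theorem inv₃_step [IsIntegral E] [IsIntegral D.subscheme] (hdim : topologicalKrullDim E ≤ 3)
    (hInv : ∃ BX : Set D.subscheme, IsStrictNormalCrossingsDivisor D.subscheme BX ∧
      (((monomialIdeal L).comap D.subschemeι).support : Set D.subscheme) ⊆ BX)
    (ζ : D.subscheme) (hζ : Order.coheight ζ = 1) (hζT : ζ ∈ ((monomialIdeal L).comap D.subschemeι).support)
    (hT : (monomialIdeal L).comap D.subschemeι ≠ ⊥)
    (hZ : Scheme.IsRegular (vanishingIdeal ⟨closure {D.subschemeι ζ}, isClosed_closure⟩).subscheme)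
    (hnc : HasSNCWith (boundaryOf L) (vanishingIdeal ⟨closure {D.subschemeι ζ}, isClosed_closure⟩)) :
    (∃ BX' : Set (controlledTransform (blowup.π (vanishingIdeal ⟨closure {D.subschemeι ζ}, isClosed_closure⟩))
        (vanishingIdeal ⟨closure {D.subschemeι ζ}, isClosed_closure⟩) D 1).subscheme,
      IsStrictNormalCrossingsDivisor _ BX' ∧
      (((monomialIdeal ((stepExp L (blowup.π (vanishingIdeal ⟨closure {D.subschemeι ζ}, isClosed_closure⟩))
          (vanishingIdeal ⟨closure {D.subschemeι ζ}, isClosed_closure⟩) (weightAt L (D.subschemeι ζ) - 1)).filter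
            fun p => decide (0 < p.2))).comap
        (controlledTransform (blowup.π (vanishingIdeal ⟨closure {D.subschemeι ζ}, isClosed_closure⟩))
          (vanishingIdeal ⟨closure {D.subschemeι ζ}, isClosed_closure⟩) D 1).subschemeι).support : Set _) ⊆ BX') ∧
    topologicalKrullDim (blowup (vanishingIdeal (⟨closure {D.subschemeι ζ}, isClosed_closure⟩ : Closeds E))) ≤ 3 := by
  haveI : AlgebraicGeometry.IsNoetherian D.subscheme := isNoetherian_subscheme D
  obtain ⟨πX, -, -, hiso, -, -, -, -, hfac, -, -⟩ := S.curve_move ζ hζ hζT hT hZ hnc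
  haveI := hiso
  refine ⟨?_, (blowup.isBlowup _).topologicalKrullDim_le hdim⟩
  rw [DepthSNC.monomialIdeal_filter_pos]
  exact snc_inv_step πX hfac hInv

/-! ## §3 Cases (a)/(c): normal crossings of the boundary with the chosen curve, from the pointwise oracle lemma -/

omit [AlgebraicGeometry.IsNoetherian E] in
/-- A codimension-one point of a regular hypersurface `X = V(D)` in `E` (order-one host equation) has
`coheight (ι x) = coheight x + 1` (Matsumura 14.2; `dim 𝒪 = coheight`). [cite: Matsumura1987, Thm. 14.2] [cite: StacksProject, Tag 02IZ] -/
theorem coheight_subschemeι_eq_add_one (x : D.subscheme) [IsRegularLocalRing (E.presheaf.stalk (D.subschemeι x))]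
    {z : E.presheaf.stalk (D.subschemeι x)} (hDx : stalkIdeal D (D.subschemeι x) = Ideal.span {z})
    (hz2 : z ∉ maximalIdeal (E.presheaf.stalk (D.subschemeι x)) ^ 2) :
    (Order.coheight (D.subschemeι x) : WithBot ℕ∞) = Order.coheight x + 1 := by
  have hsurj : Function.Surjective (D.subschemeι.stalkMap x).hom := D.subschemeι.stalkMap_surjective x
  have hker : RingHom.ker (D.subschemeι.stalkMap x).hom = Ideal.span {z} := by rw [ker_stalkMap_subschemeι, hDx]
  have hzm : z ∈ maximalIdeal (E.presheaf.stalk (D.subschemeι x)) :=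
    (Ideal.span_singleton_le_iff_mem _).mp (hDx ▸ (mem_support_iff_stalkIdeal_le D _).mp (subschemeι_apply_mem_support D x))
  let e : (E.presheaf.stalk (D.subschemeι x) ⧸ Ideal.span {z}) ≃+* D.subscheme.presheaf.stalk x :=
    (Ideal.quotEquivOfEq hker.symm).trans (RingHom.quotientKerEquivOfSurjective hsurj)
  have h1 := (IsRegularLocalRing.quotient_span_singleton hzm hz2).2
  rw [ringKrullDim_eq_of_ringEquiv e, ringKrullDim_stalk_eq_coheight, ringKrullDim_stalk_eq_coheight] at h1
  exact h1.symm

include S in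
/-- [OURS · L1 W5.2] **Cases (a)/(c) of the oracle.** At a pruned state with integral host and `Inv₃`, let `ζ` be a codimension-one point of
the trace with member `F₁ ∋ ι ζ`; assume (¬b) no codimension-one point of the trace lies on two distinct members, and (a ⇒) if some
member is tangent to the host along some trace component then `F₁` is tangent to the host along `cl{ζ}`.  Then the boundary has simple
normal crossings with `𝓘(cl{ι ζ})` — pointwise by `sncWithAt_curve_of_unique_member`, the branches at `x` being the components of the
STEP A divisor `BX` through `x` (at most two: `dim 𝒪_{X,x} ≤ 2`). [cite: Kollar2007, 3.104 Step 2.1] [cite: StacksProject, Tag 0BIA] -/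
theorem hasSNCWith_curve [IsIntegral D.subscheme] (hpos : ∀ p ∈ L, 0 < p.2) (hdim : topologicalKrullDim E ≤ 3)
    {BX : Set D.subscheme} (hBX : IsStrictNormalCrossingsDivisor D.subscheme BX)
    (hTBX : (((monomialIdeal L).comap D.subschemeι).support : Set D.subscheme) ⊆ BX)
    (hT : (monomialIdeal L).comap D.subschemeι ≠ ⊥)
    {ζ : D.subscheme} (hζ : ζ ∈ divisorialPoints ((monomialIdeal L).comap D.subschemeι))
    {F₁ : E.IdealSheafData} (h₁ : F₁ ∈ boundaryOf L) (hζ₁ : D.subschemeι ζ ∈ F₁.support)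
    (hB : ∀ ζ' ∈ divisorialPoints ((monomialIdeal L).comap D.subschemeι), ∀ F ∈ boundaryOf L, ∀ F' ∈ boundaryOf L,
      D.subschemeι ζ' ∈ F.support → D.subschemeι ζ' ∈ F'.support → F = F')
    (hA : (∃ ζ' ∈ divisorialPoints ((monomialIdeal L).comap D.subschemeι), ∃ F ∈ boundaryOf L,
        D.subschemeι ζ' ∈ F.support ∧ F.comap D.subschemeι ≤ primeDivisorIdeal ζ' ^ 2) →
      F₁.comap D.subschemeι ≤ primeDivisorIdeal ζ ^ 2) :
    HasSNCWith (boundaryOf L) (vanishingIdeal ⟨closure {D.subschemeι ζ}, isClosed_closure⟩) := by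
  classical
  haveI : AlgebraicGeometry.IsNoetherian D.subscheme := isNoetherian_subscheme D
  -- the host is regular
  have hX : Scheme.IsRegular D.subscheme := by
    intro s
    rw [isRegularLocalRing_stalk_subscheme_iff]
    haveI : IsRegularLocalRing (E.presheaf.stalk (D.subschemeι.base s)) := S.regE _
    obtain ⟨v, hv, hv2⟩ := S.hostHyp _ (subschemeι_apply_mem_support D s)
    have hvm : v ∈ maximalIdeal (E.presheaf.stalk (D.subschemeι.base s)) :=
      (Ideal.span_singleton_le_iff_mem _).mp (hv ▸ (mem_support_iff_stalkIdeal_le D _).mp (subschemeι_apply_mem_support D s))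
    rw [hv]
    exact (IsRegularLocalRing.quotient_span_singleton hvm hv2).1
  -- the components of `BX`
  obtain ⟨𝓔, h𝓔snc, h𝓔mem, h𝓔max, h𝓔U⟩ := hBX.exists_hasSNC hX
  rw [mem_divisorialPoints_iff] at hζ
  obtain ⟨hζT, hζ1⟩ := hζ
  -- `T ≤ F|_X` for members, so member traces are supported in `BX`
  have hTF : ∀ F ∈ boundaryOf L, (monomialIdeal L).comap D.subschemeι ≤ F.comap D.subschemeι := fun F hF =>
    Scheme.IdealSheafData.comap_mono (f := D.subschemeι) (monomialIdeal_le_of_mem_boundaryOf hpos hF)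
  have hFT : ∀ F ∈ boundaryOf L, ((F.comap D.subschemeι).support : Set D.subscheme) ⊆
      ((monomialIdeal L).comap D.subschemeι).support := fun F hF => support_antitone (hTF F hF)
  -- a branch of a member trace through a codimension-one point is a divisorial point of the trace
  have hDiv : ∀ (η : D.subscheme), Order.coheight η = 1 → ∀ F ∈ boundaryOf L, D.subschemeι η ∈ F.support →
      η ∈ divisorialPoints ((monomialIdeal L).comap D.subschemeι) := fun η hη F hF hηF =>
    ⟨hFT F hF ((mem_support_comap_iff D.subschemeι F η).mpr hηF), hη⟩
  refine hasSNCWith_of_pointwise S.sncB fun y hy => ?_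
  -- `y = ι x` with `ζ ⤳ x`
  have hy' : D.subschemeι ζ ⤳ y := mem_support_vanishingIdeal_closure_singleton_iff.mp hy
  have hycl : y ∈ D.subschemeι '' closure {ζ} := by
    rw [← D.subschemeι.isClosedEmbedding.closure_image_eq, Set.image_singleton]
    exact specializes_iff_mem_closure.mp hy'
  obtain ⟨x, hx, rfl⟩ := hycl
  have hζx : ζ ⤳ x := specializes_iff_mem_closure.mpr hx
  -- data at `x`
  haveI : IsRegularLocalRing (E.presheaf.stalk (D.subschemeι x)) := S.regE _
  obtain ⟨z, hDx, hz2⟩ := S.hostHyp (D.subschemeι x) (subschemeι_apply_mem_support D x)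
  obtain ⟨hregx, d, v, hd, hvspan, ⟨lab, hlabinj, hlab⟩, -⟩ := h𝓔snc.sncWithAt x
  haveI := hregx
  have hv : IsRsopPart v := by
    have h := isRsopPart_comp_of_rsop hd v hvspan id Function.injective_id
    simpa using h
  -- at most two branches: `d = dim 𝒪_{X,x} = coheight x ≤ 2`
  have hd2 : d ≤ 2 := by
    have h1 : ((d : ℕ∞) : WithBot ℕ∞) = Order.coheight x := by
      rw [← ringKrullDim_stalk_eq_coheight, ← IsRegularLocalRing.spanFinrank_maximalIdeal, hd]; rfl
    have h2 := coheight_subschemeι_eq_add_one x hDx hz2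
    have h3 : Order.coheight (D.subschemeι x) ≤ 3 := (topologicalKrullDim_le_iff_forall_coheight_le E 3).mp hdim _
    rw [← h1] at h2
    have h4 : ((d : ℕ∞) : WithBot ℕ∞) + 1 ≤ ((3 : ℕ∞) : WithBot ℕ∞) := by
      rw [← h2]; exact_mod_cast h3
    have h5 : (d : ℕ∞) + 1 ≤ 3 := by exact_mod_cast h4
    have h6 : ((d + 1 : ℕ) : ℕ∞) ≤ ((3 : ℕ) : ℕ∞) := by exact_mod_cast h5
    have h7 := ENat.coe_le_coe.mp h6
    omega
  -- generic points of the branches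
  choose gen' hgen'max hgen'eq using h𝓔mem
  let gen : {G : D.subscheme.IdealSheafData // G ∈ 𝓔 ∧ x ∈ G.support} → D.subscheme := fun G => gen' G.1 G.2.1
  have hgenV : ∀ G : {G : D.subscheme.IdealSheafData // G ∈ 𝓔 ∧ x ∈ G.support},
      G.1 = vanishingIdeal ⟨closure {gen G}, isClosed_closure⟩ := fun G => hgen'eq G.1 G.2.1
  have hgen : ∀ G, gen G ⤳ x := fun G =>
    mem_support_vanishingIdeal_closure_singleton_iff.mp (by rw [← hgenV G]; exact G.2.2)
  have hgenP : ∀ G, primeOfSpecializes (hgen G) = Ideal.span {v (lab G)} := fun G => by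
    rw [← stalkIdeal_vanishingIdeal_closure_singleton (hgen G), ← hgenV G]; exact hlab G
  have hgen1 : ∀ G, Order.coheight (gen G) = 1 := fun G => by
    have hκ : Function.Injective (fun _ : Fin 1 => lab G) := Function.injective_of_subsingleton _
    have hz : IsRsopPart (v ∘ fun _ : Fin 1 => lab G) := isRsopPart_comp_of_rsop hd v hvspan _ hκ
    have hrange : Set.range (v ∘ fun _ : Fin 1 => lab G) = {v (lab G)} := by
      rw [show (v ∘ fun _ : Fin 1 => lab G) = fun _ => v (lab G) from rfl, Set.range_const]
    have hht : (Ideal.span {v (lab G)}).height = 1 := by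
      have h := hz.height_span_range
      rw [hrange] at h
      exact_mod_cast h
    have h := coe_height_primeOfSpecializes (hgen G)
    rw [hgenP G, hht] at h
    exact_mod_cast h.symm
  -- member traces near `x` are supported in the branches
  have hsupp : ∀ F ∈ boundaryOf L, ∀ η : D.subscheme, η ⤳ x → η ∈ (F.comap D.subschemeι).support →
      ∃ G ∈ 𝓔, η ∈ G.support := by
    intro F hF η _ hηF
    have h1 : η ∈ BX := hTBX (hFT F hF hηF)
    rw [← h𝓔U] at h1
    obtain ⟨G, hG, hηG⟩ := by simpa only [Set.mem_iUnion, exists_prop] using h1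
    exact ⟨G, hG, hηG⟩
  -- the chosen branch `G₀ = 𝓘(cl ζ)`
  have hζmax : ζ ∈ maxPoints BX := DepthOne.mem_maxPoints_of_coheight_eq_one hBX hζ1 (hTBX hζT)
  let G₀ : {G : D.subscheme.IdealSheafData // G ∈ 𝓔 ∧ x ∈ G.support} :=
    ⟨primeDivisorIdeal ζ, h𝓔max ζ hζmax, (mem_support_primeDivisorIdeal_iff ζ x).mpr hζx⟩
  have hG₀ : gen G₀ = ζ := by
    have h1 : (primeDivisorIdeal ζ : D.subscheme.IdealSheafData) = vanishingIdeal ⟨closure {gen G₀}, isClosed_closure⟩ := hgenV G₀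
    have h2 : closure ({ζ} : Set D.subscheme) = closure {gen G₀} := by
      have h := congrArg (fun I : D.subscheme.IdealSheafData => (I.support : Set D.subscheme)) h1
      simpa only [coe_support_primeDivisorIdeal, Scheme.IdealSheafData.coe_support_vanishingIdeal, Closeds.coe_mk] using h
    have h3 : ζ ⤳ gen G₀ := specializes_iff_mem_closure.mpr (h2 ▸ subset_closure (Set.mem_singleton _))
    have h4 : gen G₀ ⤳ ζ := specializes_iff_mem_closure.mpr (h2.symm ▸ subset_closure (Set.mem_singleton _))
    exact (h4.antisymm h3).eq
  -- member traces through `ι x` are non-zero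
  have htr0 : ∀ F ∈ boundaryOf L, D.subschemeι x ∈ F.support → stalkIdeal (F.comap D.subschemeι) x ≠ ⊥ := by
    intro F hF _ h0
    exact stalkIdeal_ne_bot_of_ne_bot hT x (le_bot_iff.mp (h0 ▸ stalkIdeal_mono (hTF F hF) x))
  -- the priority hypotheses seen from `x`
  have hb : ∀ G, ∀ F ∈ boundaryOf L, ∀ F' ∈ boundaryOf L, D.subschemeι (gen G) ∈ F.support →
      D.subschemeι (gen G) ∈ F'.support → F = F' := fun G F hF F' hF' hGF hGF' =>
    hB (gen G) (hDiv (gen G) (hgen1 G) F hF hGF) F hF F' hF' hGF hGF'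
  have ha : (∃ G, ∃ F ∈ boundaryOf L, F.comap D.subschemeι ≤ primeDivisorIdeal (gen G) ^ 2) →
      F₁.comap D.subschemeι ≤ primeDivisorIdeal (gen G₀) ^ 2 := by
    rintro ⟨G, F, hF, hle⟩
    have hGF : D.subschemeι (gen G) ∈ F.support := by
      refine (mem_support_comap_iff D.subschemeι F (gen G)).mp (support_antitone hle ?_)
      rw [mem_support_iff_stalkIdeal_le, stalkIdeal_pow]
      exact (Ideal.pow_le_self two_ne_zero).trans
        ((mem_support_iff_stalkIdeal_le _ _).mp ((mem_support_primeDivisorIdeal_iff (gen G) (gen G)).mpr (specializes_refl _)))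
    rw [hG₀]
    exact hA ⟨gen G, hDiv (gen G) (hgen1 G) F hF hGF, F, hF, hGF, hle⟩
  have hζ₁' : D.subschemeι (gen G₀) ∈ F₁.support := by rw [hG₀]; exact hζ₁
  have key := sncWithAt_curve_of_unique_member hX x hDx hz2 (S.sncB.sncWithAt (D.subschemeι x)) htr0 hd2 hv 𝓔 lab hlabinj
    hlab gen hgen hgen1 hgenP hsupp G₀ h₁ hζ₁' hb ha
  rw [hG₀] at key
  exact key

end HostStateN

/-! ## §4 The oracle -/

/-- [OURS · L1 W5.2] **THE CURVE-CHOOSING ORACLE for `Inv₃`** (module docstring): priority (b) double curve > (a) tangency curve >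
(c) any curve; normal crossings by `hasSNCWith_vanishingIdeal_of_two_members` in case (b) and by `HostStateN.hasSNCWith_curve` in cases
(a)/(c); regularity of the curve from the normal crossings (`HasSNCWith.isRegular_subscheme`); `Inv₃` after the move by
`HostStateN.inv₃_step`. [cite: Kollar2007, 3.104 Step 2.1, (3.111) Step 3] [cite: CossartPiltant2008, proof of Prop. 4.2] -/
theorem curveOracle₃ : DepthLegal.CurveOracle.{u}
    (fun {E : Scheme.{u}} (_ _ D : E.IdealSheafData) (L : List (E.IdealSheafData × ℕ)) =>
      (∃ BX : Set D.subscheme, IsStrictNormalCrossingsDivisor D.subscheme BX ∧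
        (((monomialIdeal L).comap D.subschemeι).support : Set D.subscheme) ⊆ BX) ∧ topologicalKrullDim E ≤ 3) := by
  intro E _ _ H N D L S hXint hpos hInv hT hT'
  obtain ⟨hInv, hdim⟩ := hInv
  obtain ⟨BX, hBX, hTBX⟩ := hInv
  haveI := hXint
  -- conclude from a divisorial point whose curve is normal crossings with the boundary
  have conclude : ∀ ζ ∈ divisorialPoints ((monomialIdeal L).comap D.subschemeι),
      HasSNCWith (boundaryOf L) (vanishingIdeal ⟨closure {D.subschemeι ζ}, isClosed_closure⟩) →
      ∃ ζ : D.subscheme, Order.coheight ζ = 1 ∧ ζ ∈ ((monomialIdeal L).comap D.subschemeι).support ∧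
        Scheme.IsRegular (vanishingIdeal ⟨closure {D.subschemeι ζ}, isClosed_closure⟩).subscheme ∧
        HasSNCWith (boundaryOf L) (vanishingIdeal ⟨closure {D.subschemeι ζ}, isClosed_closure⟩) ∧
        ((∃ BX' : Set (controlledTransform (blowup.π (vanishingIdeal ⟨closure {D.subschemeι ζ}, isClosed_closure⟩))
            (vanishingIdeal ⟨closure {D.subschemeι ζ}, isClosed_closure⟩) D 1).subscheme,
          IsStrictNormalCrossingsDivisor _ BX' ∧
          (((monomialIdeal ((stepExp L (blowup.π (vanishingIdeal ⟨closure {D.subschemeι ζ}, isClosed_closure⟩))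
              (vanishingIdeal ⟨closure {D.subschemeι ζ}, isClosed_closure⟩) (weightAt L (D.subschemeι ζ) - 1)).filter
                fun p => decide (0 < p.2))).comap
            (controlledTransform (blowup.π (vanishingIdeal ⟨closure {D.subschemeι ζ}, isClosed_closure⟩))
              (vanishingIdeal ⟨closure {D.subschemeι ζ}, isClosed_closure⟩) D 1).subschemeι).support : Set _) ⊆ BX') ∧
        topologicalKrullDim (blowup (vanishingIdeal (⟨closure {D.subschemeι ζ}, isClosed_closure⟩ : Closeds E))) ≤ 3) := by
    intro ζ hζ hnc
    have hZ := hnc.isRegular_subscheme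
    exact ⟨ζ, hζ.2, hζ.1, hZ, hnc, S.inv₃_step hdim ⟨BX, hBX, hTBX⟩ ζ hζ.2 hζ.1 hT hZ hnc⟩
  by_cases hB : ∃ ζ ∈ divisorialPoints ((monomialIdeal L).comap D.subschemeι), ∃ F₂ ∈ boundaryOf L, ∃ F₃ ∈ boundaryOf L,
      F₂ ≠ F₃ ∧ D.subschemeι ζ ∈ F₂.support ∧ D.subschemeι ζ ∈ F₃.support
  · -- (b) a double curve
    obtain ⟨ζ, hζ, F₂, h₂, F₃, h₃, hne, hζ₂, hζ₃⟩ := hB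
    haveI : IsRegularLocalRing (E.presheaf.stalk (D.subschemeι ζ)) := S.regE _
    obtain ⟨z, hDz, hz2⟩ := S.hostHyp (D.subschemeι ζ) (subschemeι_apply_mem_support D ζ)
    exact conclude ζ hζ (hasSNCWith_vanishingIdeal_of_two_members S.sncB h₂ h₃ hne
      (coheight_subschemeι_eq_two ζ hζ.2 hDz hz2) hζ₂ hζ₃)
  · have hB' : ∀ ζ' ∈ divisorialPoints ((monomialIdeal L).comap D.subschemeι), ∀ F ∈ boundaryOf L, ∀ F' ∈ boundaryOf L,
        D.subschemeι ζ' ∈ F.support → D.subschemeι ζ' ∈ F'.support → F = F' := by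
      intro ζ' hζ' F hF F' hF' hζF hζF'
      by_contra hne
      exact hB ⟨ζ', hζ', F, hF, F', hF', hne, hζF, hζF'⟩
    by_cases hA : ∃ ζ ∈ divisorialPoints ((monomialIdeal L).comap D.subschemeι), ∃ F ∈ boundaryOf L,
        D.subschemeι ζ ∈ F.support ∧ F.comap D.subschemeι ≤ primeDivisorIdeal ζ ^ 2
    · -- (a) a tangency curve
      obtain ⟨ζ, hζ, F, hF, hζF, hle⟩ := hA
      exact conclude ζ hζ (S.hasSNCWith_curve hpos hdim hBX hTBX hT hζ hF hζF hB' fun _ => hle)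
    · -- (c) any curve
      obtain ⟨ζ, hζ⟩ := S.exists_mem_divisorialPoints_trace hT hT'
      obtain ⟨F₁, h₁, hζ₁⟩ := HostStateN.exists_mem_boundaryOf_of_mem_support_trace hζ.1
      exact conclude ζ hζ (S.hasSNCWith_curve hpos hdim hBX hTBX hT hζ h₁ hζ₁ hB' fun h => absurd h hA)

end DepthLegal

end Summit.ResolutionOfSingularities.ResolutionOfSingularities.Theorems

end
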